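import Mathlib
import Literature.Analysis.TotalPositivity.GeneralizedVandermonde
import Summits.ValiantsHypothesis.ValiantsHypothesis.Theses.LacunarySymmetroid
import Summits.ValiantsHypothesis.ValiantsHypothesis.Theorems.LacunarySymmetroidDoorA26ExtremalInverseDefs
import Summits.ValiantsHypothesis.ValiantsHypothesis.Theorems.LacunarySymmetroidDoorA26ExtremalInverseStubExtremalInverse
import Summits.ValiantsHypothesis.ValiantsHypothesis.Theorems.LacunarySymmetroidDoorA26ExtremalInverseReduction

/-!
# Route `LacunarySymmetroid` — crux `DoorA26` (stmt-ValiantsHypothesis-19979), line «extremal-inverse»: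
# the ROOT-SPACE NORMAL FORM of the door — `DoorA26 ↔ no K = 6 would-be Gram is a symmetroid Gram` (kernel-checked)

The line file of ideator val-idea-4 g2 says (informally, `noExtremalSymmetroid_of`): «`DoorA26` is EQUIVALENT to: no would-be Gram
`extremalGram E σ r c` (`0 < r₀ < ⋯ < r₁₉`, Sidon support, `c ≠ 0`) is a symmetroid Gram — modulo `gramForm`, `stub_extremalInverse`
and their (true) converses».  With `stub_gramForm` (…Reduction, p597978) and `stub_extremalInverse` (…StubExtremalInverse, p597463)
landed, this file proves the CONVERSES and the equivalence in the kernel: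

* `sigma_sidon_of_surj`, `sidon_of_data` — Sidon data `(E, σ)` (`E` strictly increasing, `σ` symmetric ONTO `Fin 21`,
  `E (σ i j) = dᵢ + dⱼ`) force injectivity on unordered pairs (21 ordered pairs onto 21 positions;
  `Finset.injOn_of_surjOn_of_card_le` + the landed `sidon_of_injOn`);
* `eval_gramPoly_eq_sum_fiber`, `fiberSum_extremalGram`, `gramPoly_extremalGram_isRoot` — the fewnomial of a would-be Gram is
  `c · Σ_k (−1)^k minor_k(r) X^{E_k}`, which vanishes at every node `r_a` (Laplace expansion with a repeated row:
  `Literature.Analysis.TotalPositivity.sum_pow_mul_signedMinor_eq_zero`, Pinkus 1985 III §1);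
* `gramPoly_extremalGram_ne_zero`, `card_roots_gramPoly_extremalGram` — it is nonzero (`maximalMinor_pos`, Gantmacher XIII §8) and so
  has (at least, hence exactly) twenty distinct positive roots;
* `not_doorA26_of_isSymmetroidGram_extremalGram` — **a symmetroid would-be Gram refutes the door**: from
  `extremalGram E σ r c = v vᵀ − u uᵀ − w wᵀ` the symmetric blocks `[[v_l + u_l, w_l], [w_l, v_l − u_l]]` form a pencil whose
  determinant is that fewnomial (`det_eq_gramPoly`, `gram_blocks`), with twenty positive zeros;
* `doorA26_iff_no_symmetroid_extremalGram` — **`DoorA26 ↔ ∀ (d, E, σ, r, c) Sidon/sorted/nonzero, ¬ IsSymmetroidGram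
  (extremalGram E σ r c)`**: the ROOT-SPACE NORMAL FORM of the door (pencil eliminated; unknowns = twenty roots + a Sidon support).

HONEST FRAMING.  An exact reformulation (zero slack): it decides nothing about `DoorA26` (OPEN, stmt-ValiantsHypothesis-19979), which
now reads «no `K = 6` would-be Gram has the symmetroid inertia»; the line's bet `stub_signatureLaw6` (every would-be Gram has
`n₊ ≥ 2`) is strictly stronger and untouched.  Closes no item (`--supports stmt-ValiantsHypothesis-19979`, helper).  Nothing bears on
`MatrixDescartes` (stmt-ValiantsHypothesis-18050), Conjecture B or `VP ≠ VNP`.  Width seat val-width-19979-ei1 (cell valiant-width),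
2026-08-28.  [folklore] Chebyshev-system linear algebra; sources as cited in `Literature.Analysis.TotalPositivity.GeneralizedVandermonde`.
-/

-- `Summit.ValiantsHypothesis.ValiantsHypothesis.…` repeats a component by the D-0017 layout
-- (single-conjunct summit), which the `dupNamespace` linter flags; the name is mandated.
set_option linter.dupNamespace false

namespace Summit.ValiantsHypothesis.ValiantsHypothesis.Theorems.LacunarySymmetroid.DoorA26.ExtremalInverse

open Polynomial Matrix Finset
open scoped BigOperators
open Literature.Analysis.TotalPositivity (maximalMinor_pos sum_pow_mul_signedMinor_eq_zero)

/-! ### 1. Sidon data: a symmetric position map onto `Fin 21` is injective on unordered pairs -/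

/-- A symmetric position map `σ : Fin 6 → Fin 6 → Fin 21` which is ONTO is injective on unordered pairs (`21` ordered pairs
`i ≤ j` onto `21` positions). [folklore] -/
theorem sigma_sidon_of_surj (σ : Fin 6 → Fin 6 → Fin 21) (hσ : ∀ i j, σ i j = σ j i) (hsurj : ∀ k, ∃ i j, σ i j = k) :
    ∀ i j k l, σ i j = σ k l → (i = k ∧ j = l) ∨ (i = l ∧ j = k) := by
  classical
  refine sidon_of_injOn σ hσ ?_
  refine Finset.injOn_of_surjOn_of_card_le (t := (Finset.univ : Finset (Fin 21)))
    (fun p : Fin 6 × Fin 6 => σ p.1 p.2) (fun p _ => Finset.mem_coe.mpr (Finset.mem_univ _)) ?_ ?_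
  · intro k _
    obtain ⟨i, j, hk⟩ := hsurj k
    rcases le_total i j with h | h
    · exact ⟨(i, j), Finset.mem_coe.mpr (mem_pairDom h), hk⟩
    · exact ⟨(j, i), Finset.mem_coe.mpr (mem_pairDom h), (hσ j i).trans hk⟩
  · rw [card_pairDom, Finset.card_univ, Fintype.card_fin]

/-- With Sidon data `(E, σ)` for the support `d` (`E` strictly increasing, `σ` symmetric onto, `E (σ i j) = dᵢ + dⱼ`) the
support is Sidon: `dᵢ + dⱼ = d_k + d_l → {i,j} = {k,l}`. [folklore] -/
theorem sidon_of_data {d : Fin 6 → ℕ} {E : Fin 21 → ℕ} {σ : Fin 6 → Fin 6 → Fin 21} (hE : StrictMono E)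
    (hσ : ∀ i j, σ i j = σ j i) (hEσ : ∀ i j, E (σ i j) = d i + d j) (hsurj : ∀ k, ∃ i j, σ i j = k) :
    ∀ i j k l, d i + d j = d k + d l → (i = k ∧ j = l) ∨ (i = l ∧ j = k) := by
  intro i j k l h
  refine sigma_sidon_of_surj σ hσ hsurj i j k l (hE.injective ?_)
  rw [hEσ, hEσ, h]

/-- On Sidon data the fibre of the position map over `σ i j` is the unordered pair `{(i,j), (j,i)}`. [folklore] -/
theorem filter_sigma_eq_pair_nat (σ : Fin 6 → Fin 6 → Fin 21) (hσ : ∀ i j, σ i j = σ j i)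
    (hsurj : ∀ k, ∃ i j, σ i j = k) (i j : Fin 6) :
    (Finset.univ.filter fun p : Fin 6 × Fin 6 => σ p.1 p.2 = σ i j) = {(i, j), (j, i)} := by
  ext p
  simp only [Finset.mem_filter, Finset.mem_univ, true_and, Finset.mem_insert, Finset.mem_singleton]
  constructor
  · intro h
    rcases sigma_sidon_of_surj σ hσ hsurj p.1 p.2 i j h with ⟨h1, h2⟩ | ⟨h1, h2⟩
    · exact Or.inl (Prod.ext h1 h2)
    · exact Or.inr (Prod.ext h1 h2)
  · rintro (rfl | rfl)
    · rfl
    · exact hσ j i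

/-! ### 2. Evaluating `gramPoly` along the position map; the would-be Gram's fewnomial vanishes at its roots -/

/-- Evaluation of the quadratic-form fewnomial. [folklore] -/
theorem eval_gramPoly (d : Fin 6 → ℕ) (M : Matrix (Fin 6) (Fin 6) ℝ) (x : ℝ) :
    (gramPoly d M).eval x = ∑ i, ∑ j, M i j * x ^ (d i + d j) := by
  simp [gramPoly, eval_finsetSum]

/-- Regrouping the evaluation along a position map `σ` into the exponent list `E` (`E (σ i j) = dᵢ + dⱼ`):
`(gramPoly d M)(x) = Σ_k (Σ_{σ(i,j) = k} M i j) · x^{E_k}`. [folklore] -/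
theorem eval_gramPoly_eq_sum_fiber (d : Fin 6 → ℕ) (M : Matrix (Fin 6) (Fin 6) ℝ) (E : Fin 21 → ℕ)
    (σ : Fin 6 → Fin 6 → Fin 21) (hEσ : ∀ i j, E (σ i j) = d i + d j) (x : ℝ) :
    (gramPoly d M).eval x =
      ∑ k, (∑ p ∈ Finset.univ.filter (fun p : Fin 6 × Fin 6 => σ p.1 p.2 = k), M p.1 p.2) * x ^ E k := by
  classical
  rw [eval_gramPoly, ← Fintype.sum_prod_type', ← Finset.sum_fiberwise Finset.univ
    (fun p : Fin 6 × Fin 6 => σ p.1 p.2) (fun p : Fin 6 × Fin 6 => M p.1 p.2 * x ^ (d p.1 + d p.2))]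
  refine Finset.sum_congr rfl fun k _ => ?_
  rw [Finset.sum_mul]
  refine Finset.sum_congr rfl fun p hp => ?_
  rw [← (Finset.mem_filter.mp hp).2, hEσ]

/-- The fibre sums of a would-be Gram are the signed minors: `Σ_{σ(i,j) = σ(i₀,j₀)} (extremalGram E σ r c) i j =
c · (−1)^{σ i₀ j₀} · minor_{σ i₀ j₀}` (the halving off the diagonal is undone by the two orderings). [folklore] -/
theorem fiberSum_extremalGram (E : Fin 21 → ℕ) (σ : Fin 6 → Fin 6 → Fin 21) (hσ : ∀ i j, σ i j = σ j i)
    (hsurj : ∀ k, ∃ i j, σ i j = k) (r : Fin 20 → ℝ) (c : ℝ) (i j : Fin 6) :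
    ∑ p ∈ Finset.univ.filter (fun p : Fin 6 × Fin 6 => σ p.1 p.2 = σ i j), extremalGram E σ r c p.1 p.2 =
      c * (-1 : ℝ) ^ ((σ i j : Fin 21) : ℕ) * vdmMinor r E (σ i j) := by
  classical
  rw [filter_sigma_eq_pair_nat σ hσ hsurj i j]
  by_cases hij : i = j
  · subst hij
    rw [Finset.pair_eq_singleton, Finset.sum_singleton]
    simp [extremalGram]
  · have hne : (i, j) ≠ (j, i) := fun e => hij (congrArg Prod.fst e)
    rw [Finset.sum_pair hne]
    have hji : ¬ j = i := fun e => hij e.symm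
    simp only [extremalGram, Matrix.of_apply, if_neg hij, if_neg hji, hσ j i]
    ring

/-- **A would-be Gram's fewnomial vanishes at its roots**: for Sidon data `(E, σ)` of `d` and any nodes `r`,
`gramPoly d (extremalGram E σ r c)` vanishes at every `r_a` (Laplace expansion with a repeated row,
`Literature.Analysis.TotalPositivity.sum_pow_mul_signedMinor_eq_zero`). [folklore] -/
theorem gramPoly_extremalGram_isRoot (d : Fin 6 → ℕ) (E : Fin 21 → ℕ) (σ : Fin 6 → Fin 6 → Fin 21)
    (hσ : ∀ i j, σ i j = σ j i) (hEσ : ∀ i j, E (σ i j) = d i + d j) (hsurj : ∀ k, ∃ i j, σ i j = k)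
    (r : Fin 20 → ℝ) (c : ℝ) (a : Fin 20) :
    (gramPoly d (extremalGram E σ r c)).IsRoot (r a) := by
  classical
  rw [IsRoot, eval_gramPoly_eq_sum_fiber d _ E σ hEσ]
  have hk : ∀ k : Fin 21, (∑ p ∈ Finset.univ.filter (fun p : Fin 6 × Fin 6 => σ p.1 p.2 = k),
      extremalGram E σ r c p.1 p.2) = c * (-1 : ℝ) ^ ((k : Fin 21) : ℕ) * vdmMinor r E k := by
    intro k
    obtain ⟨i, j, rfl⟩ := hsurj k
    exact fiberSum_extremalGram E σ hσ hsurj r c i j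
  simp_rw [hk]
  have h := sum_pow_mul_signedMinor_eq_zero r E a
  calc ∑ k : Fin 21, c * (-1 : ℝ) ^ ((k : Fin 21) : ℕ) * vdmMinor r E k * r a ^ E k
      = c * ∑ k : Fin 21, r a ^ E k * ((-1 : ℝ) ^ ((k : Fin 21) : ℕ) *
          (Matrix.of fun i v => r i ^ E (k.succAbove v)).det) := by
        rw [Finset.mul_sum]
        refine Finset.sum_congr rfl fun k _ => ?_
        simp only [vdmMinor]
        ring
    _ = 0 := by rw [h, mul_zero]

/-- A would-be Gram is a symmetric matrix. [folklore] -/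
theorem extremalGram_isSymm (E : Fin 21 → ℕ) (σ : Fin 6 → Fin 6 → Fin 21) (hσ : ∀ i j, σ i j = σ j i)
    (r : Fin 20 → ℝ) (c : ℝ) : (extremalGram E σ r c).IsSymm := by
  unfold Matrix.IsSymm
  ext i j
  simp only [extremalGram, Matrix.transpose_apply, Matrix.of_apply, hσ j i]
  by_cases hij : i = j
  · subst hij; rfl
  · rw [if_neg hij, if_neg (fun e => hij e.symm)]

/-- **A would-be Gram's fewnomial is not zero** (`c ≠ 0`, positive sorted roots): its coefficient at `E (σ i j)` is
`c · (−1)^{σ i j} · minor`, and the minors are positive (`maximalMinor_pos`). [folklore] -/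
theorem gramPoly_extremalGram_ne_zero (d : Fin 6 → ℕ) (E : Fin 21 → ℕ) (σ : Fin 6 → Fin 6 → Fin 21) (r : Fin 20 → ℝ)
    (c : ℝ) (hE : StrictMono E) (hσ : ∀ i j, σ i j = σ j i) (hEσ : ∀ i j, E (σ i j) = d i + d j)
    (hsurj : ∀ k, ∃ i j, σ i j = k) (hr : StrictMono r) (hr0 : 0 < r 0) (hc : c ≠ 0) :
    gramPoly d (extremalGram E σ r c) ≠ 0 := by
  classical
  have hpos : ∀ a, 0 < r a := fun a => lt_of_lt_of_le hr0 (hr.monotone (Fin.zero_le a))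
  obtain ⟨i, j, h0⟩ := hsurj 0
  intro hzero
  have hcoeff := gramPoly_coeff_pairSum d (extremalGram E σ r c) (extremalGram_isSymm E σ hσ r c)
    (sidon_of_data hE hσ hEσ hsurj) i j
  rw [hzero, coeff_zero] at hcoeff
  have hminor : 0 < vdmMinor r E (σ i j) := maximalMinor_pos r E hpos hr hE (σ i j)
  have hentry : extremalGram E σ r c i j =
      c * (-1 : ℝ) ^ ((σ i j : Fin 21) : ℕ) * vdmMinor r E (σ i j) / (if i = j then 1 else 2) := rfl
  have hsign : ((-1 : ℝ) ^ ((σ i j : Fin 21) : ℕ)) ≠ 0 := pow_ne_zero _ (by norm_num)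
  by_cases hij : i = j
  · rw [if_pos hij] at hcoeff
    rw [← hcoeff, if_pos hij, div_one] at hentry
    exact (mul_ne_zero (mul_ne_zero hc hsign) hminor.ne') hentry.symm
  · rw [if_neg hij] at hcoeff
    rw [if_neg hij] at hentry
    have h2 : extremalGram E σ r c i j = 0 := by linarith
    rw [h2] at hentry
    have : c * (-1 : ℝ) ^ ((σ i j : Fin 21) : ℕ) * vdmMinor r E (σ i j) = 0 := by linarith
    exact (mul_ne_zero (mul_ne_zero hc hsign) hminor.ne') this

/-- **A would-be Gram's fewnomial has (at least) twenty distinct positive roots.** [folklore] -/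
theorem card_roots_gramPoly_extremalGram (d : Fin 6 → ℕ) (E : Fin 21 → ℕ) (σ : Fin 6 → Fin 6 → Fin 21)
    (r : Fin 20 → ℝ) (c : ℝ) (hE : StrictMono E) (hσ : ∀ i j, σ i j = σ j i) (hEσ : ∀ i j, E (σ i j) = d i + d j)
    (hsurj : ∀ k, ∃ i j, σ i j = k) (hr : StrictMono r) (hr0 : 0 < r 0) (hc : c ≠ 0) :
    19 < ((gramPoly d (extremalGram E σ r c)).roots.toFinset.filter (fun t => 0 < t)).card := by
  classical
  have hpos : ∀ a, 0 < r a := fun a => lt_of_lt_of_le hr0 (hr.monotone (Fin.zero_le a))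
  have hne := gramPoly_extremalGram_ne_zero d E σ r c hE hσ hEσ hsurj hr hr0 hc
  have hsub : Finset.univ.image r ⊆ (gramPoly d (extremalGram E σ r c)).roots.toFinset.filter (fun t => 0 < t) := by
    intro x hx
    obtain ⟨a, -, rfl⟩ := Finset.mem_image.mp hx
    rw [Finset.mem_filter, Multiset.mem_toFinset, mem_roots hne]
    exact ⟨gramPoly_extremalGram_isRoot d E σ hσ hEσ hsurj r c a, hpos a⟩
  have hcard : (Finset.univ.image r).card = 20 := by
    rw [Finset.card_image_of_injective _ hr.injective, Finset.card_univ, Fintype.card_fin]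
  have := Finset.card_le_card hsub
  omega

/-! ### 3. From a symmetroid would-be Gram back to a pencil; the equivalence -/

/-- The Gram matrix of the symmetric blocks `S_l = [[v_l + u_l, w_l], [w_l, v_l − u_l]]` is `v vᵀ − u uᵀ − w wᵀ`. [folklore] -/
theorem gram_blocks (v u w : Fin 6 → ℝ) :
    gram (fun l => !![v l + u l, w l; w l, v l - u l]) = Matrix.vecMulVec v v - Matrix.vecMulVec u u - Matrix.vecMulVec w w := by
  ext i j
  simp [gram, Matrix.vecMulVec_apply]
  ring

/-- **A symmetroid would-be Gram refutes the door.**  If some `K = 6` would-be Gram `extremalGram E σ r c` (Sidon data for a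
support `d`, sorted positive roots, `c ≠ 0`) is a symmetroid Gram `v vᵀ − u uᵀ − w wᵀ`, then the symmetric pencil with blocks
`[[v_l + u_l, w_l], [w_l, v_l − u_l]]` on the support `d` has determinant `gramPoly d (extremalGram E σ r c)` (Gram form), which
vanishes at the twenty roots: `¬ DoorA26`. [folklore] -/
theorem not_doorA26_of_isSymmetroidGram_extremalGram (d : Fin 6 → ℕ) (E : Fin 21 → ℕ) (σ : Fin 6 → Fin 6 → Fin 21)
    (r : Fin 20 → ℝ) (c : ℝ) (hE : StrictMono E) (hσ : ∀ i j, σ i j = σ j i) (hEσ : ∀ i j, E (σ i j) = d i + d j)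
    (hsurj : ∀ k, ∃ i j, σ i j = k) (hr : StrictMono r) (hr0 : 0 < r 0) (hc : c ≠ 0)
    (hS : IsSymmetroidGram (extremalGram E σ r c)) :
    ¬ Summit.ValiantsHypothesis.ValiantsHypothesis.Theses.LacunarySymmetroid.DoorA26 := by
  obtain ⟨v, u, w, hM⟩ := hS
  intro hD
  have hsymm : ∀ l, (!![v l + u l, w l; w l, v l - u l] : Matrix (Fin 2) (Fin 2) ℝ).IsSymm := by
    intro l
    ext i j
    fin_cases i <;> fin_cases j <;> rfl
  have h19 := hD d (fun l => !![v l + u l, w l; w l, v l - u l]) hsymm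
  rw [det_eq_gramPoly d _ hsymm, gram_blocks, ← hM] at h19
  have h20 := card_roots_gramPoly_extremalGram d E σ r c hE hσ hEσ hsurj hr hr0 hc
  omega

/-- **ROOT-SPACE NORMAL FORM OF THE DOOR (the line's dictionary, both directions, kernel-checked):**
`DoorA26` (every 6-term real symmetric `2 × 2` lacunary pencil determinant has `≤ 19` distinct positive zeros) holds
**if and only if** no `K = 6` would-be Gram `extremalGram E σ r c` — Sidon data `(E, σ)` for some support `d`, sorted positive
roots `0 < r₀ < ⋯ < r₁₉`, `c ≠ 0` — is a symmetroid Gram `v vᵀ − u uᵀ − w wᵀ`.  (`→`: a symmetroid would-be Gram rebuilds a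
pencil with twenty roots, `not_doorA26_of_isSymmetroidGram_extremalGram`; `←`: a pencil with twenty roots has a Sidon support
and `gram S = extremalGram E σ r c` by the extremal inverse `stub_extremalInverse`, while `gram S` is a symmetroid Gram,
`stub_gramForm`.)  The pencil is ELIMINATED: the unknowns are twenty roots and a Sidon support.  `DoorA26` itself stays OPEN;
nothing here bears on `MatrixDescartes` or `VP ≠ VNP`. [folklore] -/
theorem doorA26_iff_no_symmetroid_extremalGram :
    Summit.ValiantsHypothesis.ValiantsHypothesis.Theses.LacunarySymmetroid.DoorA26 ↔
      ∀ (d : Fin 6 → ℕ) (E : Fin 21 → ℕ) (σ : Fin 6 → Fin 6 → Fin 21) (r : Fin 20 → ℝ) (c : ℝ),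
        StrictMono E → (∀ i j, σ i j = σ j i) → (∀ i j, E (σ i j) = d i + d j) → (∀ k, ∃ i j, σ i j = k) →
        StrictMono r → 0 < r 0 → c ≠ 0 → ¬ IsSymmetroidGram (extremalGram E σ r c) := by
  constructor
  · intro hD d E σ r c hE hσ hEσ hsurj hr hr0 hc hS
    exact not_doorA26_of_isSymmetroidGram_extremalGram d E σ r c hE hσ hEσ hsurj hr hr0 hc hS hD
  · intro h d S hS
    by_contra hlt
    push Not at hlt
    obtain ⟨hdet, hgram⟩ := stub_gramForm d S hS
    rw [hdet] at hlt
    obtain ⟨E, σ, r, c, hE, hσ, hEσ, hsurj, hr, hr0, hc, hM⟩ := stub_extremalInverse d (gram S) (gram_isSymm S) hlt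
    exact h d E σ r c hE hσ hEσ hsurj hr hr0 hc (hM ▸ hgram)

end Summit.ValiantsHypothesis.ValiantsHypothesis.Theorems.LacunarySymmetroid.DoorA26.ExtremalInverse
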